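import Literature.MathematicalPhysics.QuantumFieldTheory.Balaban1983to89.B9Thm314GFlatV1DivHolder
import Literature.MathematicalPhysics.QuantumFieldTheory.Balaban1983to89.B9Thm314HFlatV1Transfer
import Literature.MathematicalPhysics.QuantumFieldTheory.Balaban1983to89.B6Prop26HolderDivCensusV1
import Literature.MathematicalPhysics.QuantumFieldTheory.Balaban1983to89.B6Prop26PairGKLevelV1
import Literature.MathematicalPhysics.QuantumFieldTheory.Balaban1983to89.B6Prop26DivKLevelPadV1

/-!
# `Balaban1983to89.B9Thm314GFlatV1DivHolderPair` — T. Bałaban, *Propagators for lattice gauge theories in a background field*, Commun. Math. Phys. **99**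
# (1985) 389–434 [Balaban1985BackgroundPropagators], **THEOREM 3.14 (pp. 426–427, (3.154)) AT `U = 1` FOR THE GENUINE `k`-LEVEL `G = Δ_a⁻¹` ON THE V1 TORUS,
# FILE 6: THE HÖLDER MEMBER (2.137)₂ OF [4] = [Balaban1984PropagatorsII] (PAIR DIFFERENCES OF `G∇*_ν`), UNCONDITIONAL** —
# `|[(G[Ω]∇*_νμ)(x) − (G[Ω]∇*_νμ)(x′)] − [(G[Ω′]∇*_νμ)(x) − (G[Ω′]∇*_νμ)(x′)]| ≤ C(α)·√ψ(y)·√(φ(y)·|c_f|·L^{−k})·|μ|·e^{−δ·min(d,d′)(y,y′)}·e^{−δ·d(y,y′,Ω)}`,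
# `ψ(y) = (|x−x′|_∞/L^k)^α·(L^k|c_f|⁻¹)`, `φ(y) = (|x−x′|_∞/L^k)·(L^k/c_f)²` — p21's gen-23 member-modulo-inputs `B9Thm314GFlatV1DivHolder.thm314_Gdiv_holder_flat_V1_of_majorants`
# with its three one-family inputs DISCHARGED: (i) p38's (2.137)₂ census `B6Prop26HolderDivCensusV1.prop26_2137_div_kLevel_admissible`, (ii) the pair
# majorant of `G` itself `B6Prop26PairGKLevelV1.pairG_kLevel`, (iii) the (2.136)₃ entry `B6Prop26DivKLevelPadV1.prop26_2136_div_kLevel_unconditional`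
# (no existing module is touched; no definition, no fact is minted — theorems only)

statement-level skeleton of published theorems with citation tags; proofs where landed; nothing here is a claim about the Yang–Mills mass gap

PDF held: `paper:balaban1985-cmp99-background-propagators` (journal page = PDF page + 388), pp. 426–427 [PDF 38–39]: «Theorem 3.14. If we take a pair of
operators constructed for the two sequences … their difference satisfies all the inequalities characteristic for operators of the considered type, with the
additional factor exp(−δ₀d(y,y′,Ω)) … (3.154)»; `paper:balaban1984-cmp96-propagators-rt-ii` (journal page = PDF page + 222), p. 247 [PDF 25]: «‖ζ∇GJ‖_α,
‖ζG∇*J‖_α ≦ O(1)(Lʲη)^{1−α}(‖ζ‖^ξ_α + |ζ|)e^{−δ₃d(y,y′)}|J|, ξ = L^{−j} (2.137) for 0 ≦ α < 1, ζ ∈ C₀^∞(Δ̃(y))»; [4] of it = *… I*, CMP **95** (1984) p. 35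
(1.109): the Hölder quotient over pairs `x, x′` at distance at most the scale.

CITATION HEADER (lean-in-tree rule) — WHAT IS REPRODUCED.  Phase-2 file of the `lit-balaban` typed skeleton (HOME `run/shared/lean/pub/lit-balaban/`),
unit `lit-balaban-p21` (proof seat p21 gen 30; free-target protocol G.5-34(d), HOME/STATUS TAKING 2026-08-28T00:11Z; B9 fold owner r06, referee ref-4);
SKELETON row B9.Thm3.14 (cells: Thm 3.14 at `U = 1` for the genuine `k`-level `G = Δ_a⁻¹`, the Hölder member (2.137)₂, unconditional).  Sister files:
`B9Thm314GFlatV1Kernel`/`…Transfer`/`…MultiLevelTorus`/`…DivTransfer`/`…All` (FILES 1–5: the sup and `L²` members), `B9Thm314GFlatV1Holder` ((2.137)₁ modulo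
inputs; knit in `B9Thm314HFlatV1Holder.thm314_gradG_holderPair_flat_V1`), `B9Thm314GFlatV1DivHolder` (FILE H2: (2.137)₂ modulo inputs).

## WHAT THIS FILE CERTIFIES (kernel-checked)

* **`thm314_Gdiv_holderPair_flat_V1`** — THEOREM 3.14 AT `U = 1`, THE HÖLDER MEMBER (2.137)₂ FOR `G = Δ_a⁻¹`, UNCONDITIONAL: there are `δ, M₀ > 0`, `N₀ > 0`
  and, for every `α ∈ [0, 1)`, `C > 0` (on `d, L, b₀, b₁`, `α` only) such that for every V1 torus, every two nested families `D, D′` on it with `k ≥ 2` levels,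
  `M_h = L^a ≥ 8`, `R ≥ 2L²`, `P′_μ ≥ 5L`, `L ≥ 5` odd, all cubes placed for both, `M₀ ≤ L·M_h`, `N₀ + 1 ≤ R·L·M_h`, every fine factor `c_f ≠ 0`, positive weights
  `w, w′` in the global band agreeing on the common index bonds, every direction `ν`, fine bonds `x, x′` of one direction with both level functions `= k` at
  the site of `x` (print's «y ∈ Ω^{(k)}») and `|x − x′|_∞ ≤ L^k, L^{j(y(x′))}, L^{j′(y′(x′))}`, every common top block `y′`, `supp μ ⊂ B′(y′)`, `|μ| ≤ B`:
  `|[(G[Ω]∇*_νμ)(x) − (G[Ω]∇*_νμ)(x′)] − [(G[Ω′]∇*_νμ)(x) − (G[Ω′]∇*_νμ)(x′)]|`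
  `≤ C·(√(t^α·(L^k|c_f|⁻¹))·√((t·(L^k/c_f)²)·|c_f|·L^{−k})·B)·e^{−δ·min(d_T(y(x),y′), d_T′(y′(x),y′))}·e^{−δ·d(y(x),y′,Ω)}`, `t = |x − x′|_∞/L^k`
  (`G[Ω]∇*_ν = onFun (GE (domT hN D hk)) * B6LapLegKLevelV1.DVa ν c_f`; the product of the two roots equals `t^{(1+α)/2}·L^k·|c_f|⁻¹`).
  Inputs BY NAME: FILE H2's `thm314_Gdiv_holder_flat_V1_of_majorants` (the two-family engine, at `A₁ = A₃ = 1` with the one-family constants carried inside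
  `φ`, `ψ` so that `δ, M₀, N₀` do not depend on `α`), p38's `prop26_2137_div_kLevel_admissible` (hypotheses (i) for both families), this seat's `pairG_kLevel`
  ((ii)) and `prop26_2136_div_kLevel_unconditional` ((iii), at `σ₁`, `α = ½`), gen 24's `B9Thm314HFlatV1Transfer.blkV1_common_top`.

## HONEST SCOPE

* Hypotheses = the union of the inputs' settings (V1 torus, `2 ≤ k`, `M_h = Lᵃ ≥ 8`, `R ≥ 2L²`, `P′ ≥ 5L`, odd `L ≥ 5`, cubes placed for BOTH families,
  global band, common TOP blocks); `α < 1` as in print (`C(α) → ∞` is allowed as `α → 1`; here `C` depends on `α` through p38's near-pair constant only).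
* The prefactor is FILE H2's explicit geometric mean `√ψ(y)·√(φ(y)|c_f|L^{−k})` with `ψ = t^α·L^kη`, `φ = t·(L^kη)²` (`η = |c_f|⁻¹`), i.e.
  `t^{(1+α)/2}·(L^kη)`; print's (2.137)₂ prefactor is `t^α·(L^kη)` (`(Lʲη)^{1−α}|x − x′|^α` with `|x − x′| = t·Lʲη`): ours has the exponent `(1+α)/2 ≥ α`,
  hence is `≤ t^α·(L^kη)` because `t ≤ 1` (that last simplification is NOT carried out in Lean here; the statement keeps the two roots).  Rates and
  constants ours, on `d, L, b₀, b₁, α`.  Not covered here: (2.138)–(2.139), (2.140)₄₋₆ two-family; the operators `𝔊`, `G₁`, `H₁`.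
  ROUTE as FILES 1–5 and H2 (second resolvent identity (3.49)).  Nothing is inferred from the manuscript; NOT summit progress.
-/

noncomputable section

open scoped BigOperators Matrix
open Finset

namespace Literature.MathematicalPhysics.QuantumFieldTheory.Balaban1983to89.B9Thm314GFlatV1DivHolderPair

open LatticeFieldCalculus (supDist)
open B4Reflection242 (boxDom)
open B6MultiLevelBoxOperator (N0)
open B6MultiLevelTorusOperator (TDomains)
open B6Cover236MultiLevelBlocks (cubes)
open B6Geom246MultiLevelBox (bset)
open B6Geom246MultiLevelTorus (geomT triangle_refl_nonneg_T)
open B8Ineq192MultiLevelTorus (geomT_len)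
open B6RandomWalk (HasMajorant BlockSupp hasMajorant_mono)
open B6Ineq2133TwoScaleV1 (onFun)
open B6SectAOperatorsV1 (BondIdx)
open B6SectAVectorModelV1 (GE)
open B6GlobalChartV1 (PV toBox blkV1 domT)
open B9Thm314GpFlatTorusGeometry (dOmega dOmega_nonneg)
open B6Prop26KLevelSkeletonV1 (pref pref_nonneg)
open B6CubeWindowV1 (Placed GlobalBand)
open B6LapLegKLevelV1 (DVa)
open B6HolderPairMemberV1 (pairOp)
open B9Thm314GFlatV1DivHolder (thm314_Gdiv_holder_flat_V1_of_majorants)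
open B9Thm314HFlatV1Transfer (blkV1_common_top)
open B6Prop26HolderDivCensusV1 (prop26_2137_div_kLevel_admissible)
open B6Prop26PairGKLevelV1 (pairG_kLevel)
open B6Prop26DivKLevelPadV1 (prop26_2136_div_kLevel_unconditional)

variable {d ℓ m K : ℕ} {hd : 1 ≤ d + 1} {hL : Odd (ℓ + 1) ∧ 1 < ℓ + 1} {Mh k R : ℕ} {P' : Fin (d + 1) → ℕ}

/-- `P_{x,x′}·G·∇*_ν = P_{x,x′}∘(G·∇*_ν)` (re-association; `*` of `Module.End` is composition). [folklore] -/
private theorem pairOp_mul_mul_eq_comp (hN : ∀ μ, N0 ℓ Mh k P' μ = (PV d ℓ m K hd hL).sitesPerDir 0) (D₀ : TDomains d ℓ Mh k P' R)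
    (hk : k ≤ m + K) {cf : ℝ} (hcf : cf ≠ 0) {w : BondIdx (domT hN D₀ hk) → ℝ} (hw : ∀ i, 0 < w i) (ν : Fin (d + 1))
    (x x' : PBond (PV d ℓ m K hd hL) 0) :
    pairOp x x' * onFun (GE (domT hN D₀ hk) hcf hw) * DVa (P := PV d ℓ m K hd hL) ν cf
      = pairOp x x' ∘ₗ (onFun (GE (domT hN D₀ hk) hcf hw) * DVa ν cf : Module.End ℝ (PBond (PV d ℓ m K hd hL) 0 → ℝ)) := by
  rw [mul_assoc]; rfl

/-- rate weakening of an exponential kernel. [folklore] -/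
private theorem exp_le_exp_of_rate {ρ σ t : ℝ} (h : σ ≤ ρ) (ht : 0 ≤ t) : Real.exp (-(ρ * t)) ≤ Real.exp (-(σ * t)) :=
  Real.exp_le_exp.2 (by nlinarith)

/-! ## THEOREM 3.14 AT `U = 1`: the (2.137)₂ member (pair differences of `G∇*_ν`) for `G = Δ_a⁻¹`, UNCONDITIONAL -/

/-- **[B9] THEOREM 3.14 (3.154) AT `U = 1` — THE HÖLDER MEMBER (2.137)₂ (PAIR DIFFERENCES OF `G∇*_ν`) FOR THE GENUINE `k`-LEVEL `G = Δ_a⁻¹` OF TWO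
NESTED FAMILIES ON THE V1 TORUS, UNCONDITIONAL.**  There are `δ, M₀, N₀ > 0` and, for every `α ∈ [0, 1)`, `C > 0` (on `d, L, b₀, b₁`, `α` only) such
that for every V1 torus, every two nested families `D, D′` with `k ≥ 2` levels, `M_h = L^a ≥ 8`, `R ≥ 2L²`, `P′ ≥ 5L`, `L ≥ 5` odd, placed cubes for both,
`M₀ ≤ L·M_h`, `N₀ + 1 ≤ R·L·M_h`, `c_f ≠ 0`, band weights agreeing on common index pairs, every direction `ν`, fine bonds `x, x′` of one direction with both
levels `= k` at the site of `x` and `|x − x′|_∞ ≤ L^k, L^{j(x′)}, L^{j′(x′)}`, every common top block `y′` and `supp μ ⊂ B′(y′)`, `|μ| ≤ B`: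
`|[(G[Ω]∇*_νμ)(x) − (G[Ω]∇*_νμ)(x′)] − [(G[Ω′]∇*_νμ)(x) − (G[Ω′]∇*_νμ)(x′)]|`
`≤ C·(√(t^α·(len(y(x))·|c_f|⁻¹))·√((t·pref c_f y(x))·|c_f|·L^{−k})·B)·e^{−δ·min(d_T(y(x),y′), d_T′(y′(x),y′))}·e^{−δ·d(y(x),y′,Ω)}`, `t = |x − x′|_∞/L^k`
— print's «their difference satisfies all the inequalities characteristic for operators of the considered type [(2.137)₂], with the additional factor
exp(−δ₀d(y, y′, Ω))»: FILE H2's `thm314_Gdiv_holder_flat_V1_of_majorants` with its pair majorants (i) DISCHARGED by p38's `prop26_2137_div_kLevel_admissible`,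
its pair majorant of `G` (ii) by `B6Prop26PairGKLevelV1.pairG_kLevel` and its (2.136)₃ majorant (iii) by `B6Prop26DivKLevelPadV1.prop26_2136_div_kLevel_unconditional`.
[cite: Balaban1985BackgroundPropagators, Thm 3.14 (3.153)–(3.154) pp.426–427; Balaban1984PropagatorsII, Prop. 2.6 (2.136)–(2.137) p.247; Balaban1984PropagatorsI, (1.109) p.35] -/
theorem thm314_Gdiv_holderPair_flat_V1 (d ℓ : ℕ) (hd : 1 ≤ d + 1) (hL : Odd (ℓ + 1) ∧ 1 < ℓ + 1) {b₀ b₁ : ℝ} (hb₀ : 0 < b₀)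
    (hb₁ : b₀ ≤ b₁) :
    ∃ δ M₀ : ℝ, ∃ N₀ : ℕ, 0 < δ ∧ 0 < M₀ ∧ 0 < N₀ ∧ ∀ α : ℝ, 0 ≤ α → α < 1 → ∃ C : ℝ, 0 < C ∧
      ∀ (m K : ℕ) {Mh k R : ℕ} {P' : Fin (d + 1) → ℕ}
        (hN : ∀ μ, N0 ℓ Mh k P' μ = (PV d ℓ m K hd hL).sitesPerDir 0) (D D' : TDomains d ℓ Mh k P' R) (hk : k ≤ m + K),
        2 ≤ k → ∀ {a : ℕ}, Mh = (ℓ + 1) ^ a → 8 ≤ Mh → 2 * (ℓ + 1) ^ 2 ≤ R → (∀ μ, 5 * (ℓ + 1) ≤ P' μ) → 4 ≤ ℓ →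
        (∀ c : ↥(cubes D.toDomains), Placed ℓ k P' c.1) → (∀ c : ↥(cubes D'.toDomains), Placed ℓ k P' c.1) →
        M₀ ≤ ((ℓ : ℝ) + 1) * Mh → N₀ + 1 ≤ R * ((ℓ + 1) * Mh) →
        ∀ {cf : ℝ} (hcf : cf ≠ 0) {w : BondIdx (domT hN D hk) → ℝ} (hw : ∀ i, 0 < w i)
          {w' : BondIdx (domT hN D' hk) → ℝ} (hw' : ∀ i', 0 < w' i'),
        GlobalBand b₀ b₁ cf w → GlobalBand b₀ b₁ cf w' →
        (∀ (i : BondIdx (domT hN D hk)) (i' : BondIdx (domT hN D' hk)), i.1 = i'.1 → w i = w' i') →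
        ∀ (ν : Fin (d + 1)) (x x' : PBond (PV d ℓ m K hd hL) 0), x.dir = x'.dir →
        D.lev (toBox hN x.src).1 = k → D'.lev (toBox hN x.src).1 = k →
        supDist x.src x'.src ≤ (ℓ + 1) ^ k → supDist x.src x'.src ≤ (ℓ + 1) ^ (blkV1 hN D x').1.1 →
        supDist x.src x'.src ≤ (ℓ + 1) ^ (blkV1 hN D' x').1.1 →
        ∀ (y' : ↥(bset D'.toDomains)) (hy'D : y'.1 ∈ bset D.toDomains), y'.1.1 = k →
        ∀ (μ : PBond (PV d ℓ m K hd hL) 0 → ℝ) (B : ℝ), BlockSupp (g := geomT D') (blkV1 hN D') μ y' B →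
          |((onFun (GE (domT hN D hk) hcf hw) * DVa ν cf : Module.End ℝ (PBond (PV d ℓ m K hd hL) 0 → ℝ)) μ x
              - (onFun (GE (domT hN D hk) hcf hw) * DVa ν cf : Module.End ℝ (PBond (PV d ℓ m K hd hL) 0 → ℝ)) μ x')
            - ((onFun (GE (domT hN D' hk) hcf hw') * DVa ν cf : Module.End ℝ (PBond (PV d ℓ m K hd hL) 0 → ℝ)) μ x
              - (onFun (GE (domT hN D' hk) hcf hw') * DVa ν cf : Module.End ℝ (PBond (PV d ℓ m K hd hL) 0 → ℝ)) μ x')|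
            ≤ C * (Real.sqrt (((((supDist x.src x'.src : ℕ) : ℝ) / (((ℓ + 1 : ℕ) : ℝ)) ^ k) ^ α) * ((geomT D).len (blkV1 hN D x) * |cf|⁻¹))
                  * Real.sqrt (((((supDist x.src x'.src : ℕ) : ℝ) / (((ℓ + 1 : ℕ) : ℝ)) ^ k) * pref cf (blkV1 hN D x))
                      * (|cf| * ((((ℓ : ℝ) + 1) ^ k))⁻¹)) * B)
              * Real.exp (-(δ * min ((geomT D).dist (blkV1 hN D x) ⟨y'.1, hy'D⟩) ((geomT D').dist (blkV1 hN D' x) y')))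
              * Real.exp (-(δ * dOmega D D' (blkV1 hN D x).1.2 y'.1.2)) := by
  -- (i) p38's (2.137)₂ census: `δ₁, M₁, N₁` before `α`, `A(α)` after
  obtain ⟨δ₁, M₁, N₁, hδ₁, hM₁, hP38⟩ := prop26_2137_div_kLevel_admissible d ℓ hd hL hb₀ hb₁
  -- (ii) the pair majorant of `G` itself
  obtain ⟨δ₂, A₂, M₂, hδ₂, hA₂, hM₂, hPair⟩ := pairG_kLevel d ℓ hd hL hb₀ hb₁
  -- (iii) the (2.136)₃ entry at `σ₁`, `α = ½`
  obtain ⟨σ₁, hσ₁, hDiv0⟩ := prop26_2136_div_kLevel_unconditional d ℓ hd hL hb₀ hb₁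
  obtain ⟨A₃, M₃, hA₃, hM₃, hDiv⟩ := hDiv0 σ₁ hσ₁ le_rfl (1 / 2) (by norm_num) (by norm_num)
  have hδ3 : (0 : ℝ) < (1 - 1 / 2) * σ₁ / 2 := by
    have : (0 : ℝ) < 1 - 1 / 2 := by norm_num
    positivity
  -- the common input rate
  obtain ⟨δ₀, hδ₀, hδ₀1, hδ₀2, hδ₀3⟩ : ∃ δ₀ : ℝ, 0 < δ₀ ∧ δ₀ ≤ δ₁ ∧ δ₀ ≤ δ₂ ∧ δ₀ ≤ (1 - 1 / 2) * σ₁ / 2 :=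
    ⟨min δ₁ (min δ₂ ((1 - 1 / 2) * σ₁ / 2)), lt_min hδ₁ (lt_min hδ₂ hδ3), min_le_left _ _,
      (min_le_right _ _).trans (min_le_left _ _), (min_le_right _ _).trans (min_le_right _ _)⟩
  -- the two-family engine (FILE H2) at `A₁ = A₃ = 1`, `A₂ = A₃(div)`, rate `δ₀`
  obtain ⟨δ, C, M₀, N₀, hδ, hC, hM₀, hN₀, hE⟩ :=
    thm314_Gdiv_holder_flat_V1_of_majorants d ℓ hd hL hb₀ hb₁ (A₁ := 1) (A₂ := A₃) (A₃ := 1) zero_le_one hA₃ zero_le_one hδ₀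
  refine ⟨δ, max M₀ (max M₁ (max M₂ M₃)), max N₀ N₁, hδ, lt_max_of_lt_left hM₀, lt_max_of_lt_left hN₀, fun α hα0 hα1 => ?_⟩
  obtain ⟨Aα, hAα, hP38α⟩ := hP38 α hα0 hα1
  refine ⟨C * (Real.sqrt (Aα + 1) * Real.sqrt (A₂ + 1)), by positivity, ?_⟩
  intro m K Mh k R P' hN D D' hk hk2 a hMha hM8 hR2 hP5L hℓ hplD hplD' hM hRN cf hcf w hw w' hw' hwb hwb' hww ν x x' hdir hxD hxD'
    hs hsD hsD' y' hy'D hy'k μ B hμ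
  have hk1 : 1 ≤ k := le_trans (by norm_num) hk2
  have hMh1 : 1 ≤ Mh := le_trans (by norm_num) hM8
  have hP5 : ∀ μ, 5 ≤ P' μ := fun μ => le_trans (Nat.le_mul_of_pos_right 5 (Nat.succ_pos ℓ)) (hP5L μ)
  have hP1 : ∀ μ, 1 ≤ P' μ := fun μ => le_trans (by norm_num) (hP5 μ)
  have hM0 : M₀ ≤ ((ℓ : ℝ) + 1) * Mh := (le_max_left _ _).trans hM
  have hM1' : M₁ ≤ ((ℓ : ℝ) + 1) * Mh := ((le_max_left _ _).trans (le_max_right _ _)).trans hM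
  have hM2' : M₂ ≤ ((ℓ : ℝ) + 1) * Mh := (((le_max_left _ _).trans (le_max_right _ _)).trans (le_max_right _ _)).trans hM
  have hM3' : M₃ ≤ ((ℓ : ℝ) + 1) * Mh := (((le_max_right _ _).trans (le_max_right _ _)).trans (le_max_right _ _)).trans hM
  have hN0 : N₀ + 1 ≤ R * ((ℓ + 1) * Mh) := le_trans (Nat.succ_le_succ (le_max_left _ _)) hRN
  have hN1' : N₁ + 1 ≤ R * ((ℓ + 1) * Mh) := le_trans (Nat.succ_le_succ (le_max_right _ _)) hRN
  have hd0 : ∀ s t : ↥(bset D.toDomains), 0 ≤ (geomT D).dist s t := (triangle_refl_nonneg_T D hMh1 hP1).2.2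
  have hd0' : ∀ s t : ↥(bset D'.toDomains), 0 ≤ (geomT D').dist s t := (triangle_refl_nonneg_T D' hMh1 hP1).2.2
  -- the common top block of `x`
  obtain ⟨hy, hyD', hy', hy'D2, hlab⟩ := blkV1_common_top hN D D' x hxD hxD'
  have hyy : (⟨(blkV1 hN D x).1, hyD'⟩ : ↥(bset D'.toDomains)) = blkV1 hN D' x :=
    Subtype.ext (Prod.ext (hy.trans hy'.symm) hlab.symm)
  -- the Hölder parameter and the prefactors
  set t : ℝ := (((supDist x.src x'.src : ℕ) : ℝ) / (((ℓ + 1 : ℕ) : ℝ)) ^ k) with ht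
  have ht0 : 0 ≤ t := by positivity
  have htα0 : 0 ≤ t ^ α := Real.rpow_nonneg ht0 _
  have hlen0 : ∀ s : ↥(bset D.toDomains), 0 ≤ (geomT D).len s * |cf|⁻¹ := fun s => by rw [geomT_len]; positivity
  have hlen0' : ∀ s : ↥(bset D'.toDomains), 0 ≤ (geomT D').len s * |cf|⁻¹ := fun s => by rw [geomT_len]; positivity
  set ψ : ↥(bset D.toDomains) → ℝ := fun s => (Aα + 1) * (t ^ α * ((geomT D).len s * |cf|⁻¹)) with hψ
  set ψ' : ↥(bset D'.toDomains) → ℝ := fun s => (Aα + 1) * (t ^ α * ((geomT D').len s * |cf|⁻¹)) with hψ'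
  set φ : ↥(bset D.toDomains) → ℝ := fun s => (A₂ + 1) * (t * pref cf s) with hφ
  have hψ0 : ∀ s, 0 ≤ ψ s := fun s => mul_nonneg (by positivity) (mul_nonneg htα0 (hlen0 s))
  have hψ0' : ∀ s, 0 ≤ ψ' s := fun s => mul_nonneg (by positivity) (mul_nonneg htα0 (hlen0' s))
  have hφ0 : ∀ s, 0 ≤ φ s := fun s => mul_nonneg (by positivity) (mul_nonneg ht0 (pref_nonneg cf s))
  have hφeq : ψ' ⟨(blkV1 hN D x).1, hyD'⟩ = ψ (blkV1 hN D x) := rfl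
  -- (i) for the two families, the level of `x` read as `k`, at the common rate, constants inside `ψ`
  have hsD1 : supDist x.src x'.src ≤ (ℓ + 1) ^ (blkV1 hN D x).1.1 := by rw [hy]; exact hs
  have hsD'1 : supDist x.src x'.src ≤ (ℓ + 1) ^ (blkV1 hN D' x).1.1 := by rw [hy']; exact hs
  have hMD := hP38α m K hN D hk hk2 hMha hM8 hR2 hP5 hℓ hplD hM1' hN1' hcf hw hwb ν x x' hdir hsD1 hsD
  have hMD' := hP38α m K hN D' hk hk2 hMha hM8 hR2 hP5 hℓ hplD' hM1' hN1' hcf hw' hwb' ν x x' hdir hsD'1 hsD'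
  rw [hy, pairOp_mul_mul_eq_comp] at hMD
  rw [hy', pairOp_mul_mul_eq_comp] at hMD'
  have hS : HasMajorant (g := geomT D) (blkV1 hN D)
      (pairOp x x' ∘ₗ (onFun (GE (domT hN D hk) hcf hw) * DVa ν cf : Module.End ℝ (PBond (PV d ℓ m K hd hL) 0 → ℝ)))
      (fun s b => 1 * ψ s * Real.exp (-(δ₀ * (geomT D).dist s b))) := by
    refine hasMajorant_mono (g := geomT D) (blkV1 hN D) hMD fun s b => ?_
    rw [← ht]
    have h1 : Aα * (t ^ α * ((geomT D).len s * |cf|⁻¹)) ≤ 1 * ψ s := by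
      rw [hψ, one_mul]; exact mul_le_mul_of_nonneg_right (by linarith) (mul_nonneg htα0 (hlen0 s))
    exact mul_le_mul h1 (exp_le_exp_of_rate hδ₀1 (hd0 s b)) (Real.exp_nonneg _) (by rw [one_mul]; exact hψ0 s)
  have hS' : HasMajorant (g := geomT D') (blkV1 hN D')
      (pairOp x x' ∘ₗ (onFun (GE (domT hN D' hk) hcf hw') * DVa ν cf : Module.End ℝ (PBond (PV d ℓ m K hd hL) 0 → ℝ)))
      (fun s b => 1 * ψ' s * Real.exp (-(δ₀ * (geomT D').dist s b))) := by
    refine hasMajorant_mono (g := geomT D') (blkV1 hN D') hMD' fun s b => ?_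
    rw [← ht]
    have h1 : Aα * (t ^ α * ((geomT D').len s * |cf|⁻¹)) ≤ 1 * ψ' s := by
      rw [hψ', one_mul]; exact mul_le_mul_of_nonneg_right (by linarith) (mul_nonneg htα0 (hlen0' s))
    exact mul_le_mul h1 (exp_le_exp_of_rate hδ₀1 (hd0' s b)) (Real.exp_nonneg _) (by rw [one_mul]; exact hψ0' s)
  -- (ii) the pair majorant of `G[Ω]`, constant inside `φ`
  have hPD := hPair m K hN D hk hk2 hMha hM8 hR2 hP5 hℓ hplD hM2' hcf hw hwb x x' hdir hsD1
  rw [hy] at hPD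
  have hP2 : HasMajorant (g := geomT D) (blkV1 hN D) (pairOp x x' ∘ₗ onFun (GE (domT hN D hk) hcf hw))
      (fun s b => 1 * φ s * Real.exp (-(δ₀ * (geomT D).dist s b))) := by
    refine hasMajorant_mono (g := geomT D) (blkV1 hN D) hPD fun s b => ?_
    rw [← ht]
    have h1 : A₂ * (t * pref cf s) ≤ 1 * φ s := by
      rw [hφ, one_mul]; exact mul_le_mul_of_nonneg_right (by linarith) (mul_nonneg ht0 (pref_nonneg cf s))
    exact mul_le_mul h1 (exp_le_exp_of_rate hδ₀2 (hd0 s b)) (Real.exp_nonneg _) (by rw [one_mul]; exact hφ0 s)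
  -- (iii) the (2.136)₃ majorant of `G[Ω′]∇*_ν`
  have hT3 : HasMajorant (g := geomT D') (blkV1 hN D') (onFun (GE (domT hN D' hk) hcf hw') * DVa ν cf)
      (fun s b => A₃ * ((geomT D').len s * |cf|⁻¹) * Real.exp (-(δ₀ * (geomT D').dist s b))) :=
    hasMajorant_mono (g := geomT D') (blkV1 hN D') (hDiv m K hN D' hk hk2 hMha hM8 hR2 hP5 hℓ hplD' hM3' hcf hw' hwb' ν) fun s b =>
      mul_le_mul_of_nonneg_left (exp_le_exp_of_rate hδ₀3 (hd0' s b)) (mul_nonneg hA₃ (hlen0' s))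
  -- the engine
  have h := hE m K hN D D' hk hk1 hMha hM8 hR2 hP5L hℓ hM0 hN0 hcf hw hw' hwb hwb' hww ν x x' φ ψ ψ' hφ0 hψ0 hψ0' hS hS' hP2 hT3
    (blkV1 hN D x) hyD' y' hy'D hy hy'k hφeq μ B hμ rfl
  rw [hyy] at h
  refine h.trans (le_of_eq ?_)
  -- bookkeeping of the constant: the roots of the constants come out of the prefactors
  have hX0 : 0 ≤ t ^ α * ((geomT D).len (blkV1 hN D x) * |cf|⁻¹) := mul_nonneg htα0 (hlen0 _)
  have e1 : Real.sqrt (ψ (blkV1 hN D x)) = Real.sqrt (Aα + 1) * Real.sqrt (t ^ α * ((geomT D).len (blkV1 hN D x) * |cf|⁻¹)) := by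
    rw [hψ]; exact Real.sqrt_mul (by positivity) _
  have e2 : Real.sqrt (φ (blkV1 hN D x) * (|cf| * ((((ℓ : ℝ) + 1) ^ k))⁻¹))
      = Real.sqrt (A₂ + 1) * Real.sqrt ((t * pref cf (blkV1 hN D x)) * (|cf| * ((((ℓ : ℝ) + 1) ^ k))⁻¹)) := by
    rw [hφ, mul_assoc]; exact Real.sqrt_mul (by positivity) _
  rw [e1, e2]
  ring

end Literature.MathematicalPhysics.QuantumFieldTheory.Balaban1983to89.B9Thm314GFlatV1DivHolderPair

end
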